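import Mathlib
import Summits.ValiantsHypothesis.ValiantsHypothesis.Theorems.NewtonTauWeak.Negative.Zonogon
import Summits.ValiantsHypothesis.ValiantsHypothesis.Theorems.NewtonUnitEquationsNewtonTauWeakSeparatedRank
import Summits.ValiantsHypothesis.ValiantsHypothesis.Theorems.NewtonUnitEquationsNewtonTauWeakVdpDefs
import Summits.ValiantsHypothesis.ValiantsHypothesis.Theorems.NewtonUnitEquationsNewtonTauWeakStubVertexCharts
import Summits.ValiantsHypothesis.ValiantsHypothesis.Theorems.NewtonUnitEquationsNewtonTauWeakStubChartPairCount
import Summits.ValiantsHypothesis.ValiantsHypothesis.Theorems.NewtonUnitEquationsNewtonTauWeakStubProductVertices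

/-!
# `NewtonUnitEquationsNewtonTauWeakHexagonVertexTools` — Δ-Wronskian rung, HexagonVertexTools

Rung toward `stub_binomialNewtonTauCommon` (crux `NewtonTauWeak`, stmt-ValiantsHypothesis-5904), line
`binomial-normal-form`, lead c3: the GLOBAL Δ-WRONSKIAN argument for sums of three hexagon products
`A(x)·B(y)·C(xy)` (exponent lists on the three lines through `(1,0)`, `(0,1)`, `(1,1)`; any degrees).

This file: Newton-vertex counts of products via the LANDED chart machinery of the vdp line (`stub_vertexCharts`, `stub_chartPairCount`, `ProductVertices.isTop_mul`): `V(pq) ≤ 2(V p + V q)` (registered stub `hex_newtonVertexCount_mul_le`), `V(D) ≤ 4` for diagonal `D`, and `vert(D·m) ≤ 8 + 8R` for `m` separated of rank `R` (registered stub `hex_vert_diag_mul_le`).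

Conventions (spelled inline, no new definitions): `Δ` is ANY self-map of `ℂ[X,Y]` with
`coeff e (Δ p) = (e₀ - e₁) · coeff e p` (the Euler derivation `X∂_X - Y∂_Y`, which kills the diagonal
direction); "x-only" `P` means `∀ e ∈ P.support, e 1 = 0`, "y-only" `∀ e ∈ Q.support, e 0 = 0`, "diagonal"
`∀ e ∈ D.support, e 0 = e 1`; "separated of rank `R`" means `m = Σ_{r<R} P_r · Q_r` with `P_r` x-only and
`Q_r` y-only. [folklore]
-/

set_option linter.dupNamespace false

noncomputable section

namespace Summit.ValiantsHypothesis.ValiantsHypothesis.Theorems.NewtonUnitEquationsNewtonTauWeak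

open scoped BigOperators
open MvPolynomial
open Literature.Computability.AlgebraicComplexity (newtonVertexCount)
open Summit.ValiantsHypothesis.ValiantsHypothesis.Theorems.NewtonTauWeakVdp
open Summit.ValiantsHypothesis.ValiantsHypothesis.Theorems.NewtonTauWeak.Negative (vert)

namespace HexagonVertexToolsAux

/-- Along a chart `(σ, t)`, every strict top of `p * q` at a generic time is the sum `b + a` of
the simultaneous strict tops `a` of `p` and `b` of `q` (`ProductVertices.isTop_mul`, uniqueness of
tops); stated with the base changes to `ℂ[μ][X,Y]`, which do not move tops. [folklore] -/
theorem chartTops_mul_subset (σ : ℝ) (p q : MvPolynomial (Fin 2) ℂ) (hp : p ≠ 0) (hq : q ≠ 0) :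
    {e : Fin 2 →₀ ℕ | ∃ t : ℝ, IsGeneric ![σ, t] ∧ IsTop ![σ, t] (p * q) e} ⊆
      (fun ab : (Fin 2 →₀ ℕ) × (Fin 2 →₀ ℕ) => ab.2 + ab.1) ''
        {ab : (Fin 2 →₀ ℕ) × (Fin 2 →₀ ℕ) |
          ∃ t : ℝ, IsGeneric ![σ, t] ∧ IsTop ![σ, t] (baseChange q) ab.1 ∧
            IsTop ![σ, t] (baseChange p) ab.2} := by
  rintro e ⟨t, hgen, he⟩
  obtain ⟨a, ha⟩ := exists_isTop hgen hp
  obtain ⟨b, hb⟩ := exists_isTop hgen hq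
  refine ⟨(b, a),
    ⟨t, hgen, (isTop_baseChange_iff _ _ _).mpr hb, (isTop_baseChange_iff _ _ _).mpr ha⟩, ?_⟩
  exact (ProductVertices.isTop_mul ha hb).unique he

/-- Along a chart `(σ, t)`, a strict top of a polynomial supported on the diagonal is the support
point with the largest first coordinate if `σ + t ≥ 0` and the one with the smallest first
coordinate if `σ + t < 0` (all weighted degrees are `(σ + t) e₀`). [folklore] -/
theorem chartTops_diag_subset (σ : ℝ) (D : MvPolynomial (Fin 2) ℂ) (hD : ∀ e ∈ D.support, e 0 = e 1)
    {eMax eMin : Fin 2 →₀ ℕ} (hMax : eMax ∈ D.support) (hMax' : ∀ e ∈ D.support, e 0 ≤ eMax 0)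
    (hMin : eMin ∈ D.support) (hMin' : ∀ e ∈ D.support, eMin 0 ≤ e 0) :
    {e : Fin 2 →₀ ℕ | ∃ t : ℝ, IsGeneric ![σ, t] ∧ IsTop ![σ, t] D e} ⊆ {eMax, eMin} := by
  rintro e ⟨t, -, he⟩
  have hwd : ∀ e' ∈ D.support, wdeg ![σ, t] e' = (σ + t) * ((e' 0 : ℕ) : ℝ) := by
    intro e' he'
    rw [ChartPairCount.wdeg_chart, ← hD e' he']
    ring
  simp only [Set.mem_insert_iff, Set.mem_singleton_iff]
  rcases le_or_gt 0 (σ + t) with hst | hst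
  · left
    by_contra hne
    have hlt := he.lt hMax (Ne.symm hne)
    rw [hwd _ hMax, hwd _ he.mem] at hlt
    have hle : ((e 0 : ℕ) : ℝ) ≤ ((eMax 0 : ℕ) : ℝ) := by exact_mod_cast hMax' e he.mem
    exact absurd (hlt.trans_le (mul_le_mul_of_nonneg_left hle hst)) (lt_irrefl _)
  · right
    by_contra hne
    have hlt := he.lt hMin (Ne.symm hne)
    rw [hwd _ hMin, hwd _ he.mem] at hlt
    have hle : ((eMin 0 : ℕ) : ℝ) ≤ ((e 0 : ℕ) : ℝ) := by exact_mod_cast hMin' e he.mem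
    exact absurd (hlt.trans_le (mul_le_mul_of_nonpos_left hle hst.le)) (lt_irrefl _)

end HexagonVertexToolsAux

/-- Along a chart, the tops of `p * q` are sums of simultaneous tops; so their number is at most
`V(p) + V(q)` (`stub_chartPairCount` after base change). -/
theorem hex_ncard_chartTops_mul_le (σ : ℝ) (hσ : σ = 1 ∨ σ = -1) (p q : MvPolynomial (Fin 2) ℂ)
    (hp : p ≠ 0) (hq : q ≠ 0) :
    {e : Fin 2 →₀ ℕ | ∃ t : ℝ, IsGeneric ![σ, t] ∧ IsTop ![σ, t] (p * q) e}.ncard ≤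
      newtonVertexCount p + newtonVertexCount q := by
  have hfin : {ab : (Fin 2 →₀ ℕ) × (Fin 2 →₀ ℕ) |
      ∃ t : ℝ, IsGeneric ![σ, t] ∧ IsTop ![σ, t] (baseChange q) ab.1 ∧
        IsTop ![σ, t] (baseChange p) ab.2}.Finite :=
    ((ChartPairCount.tops_finite (baseChange q)).prod
        (ChartPairCount.tops_finite (baseChange p))).subset
      (by
        rintro ⟨a, b⟩ ⟨t, -, ha, hb⟩
        exact Set.mk_mem_prod ⟨_, ha⟩ ⟨_, hb⟩)
  have hcount := stub_chartPairCount σ hσ (baseChange p) (baseChange q)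
  rw [newtonVertexCount_baseChange, newtonVertexCount_baseChange] at hcount
  exact (Set.ncard_le_ncard (HexagonVertexToolsAux.chartTops_mul_subset σ p q hp hq)
    (hfin.image _)).trans ((Set.ncard_image_le hfin).trans hcount)

/-- `hex_newtonVertexCount_mul_le` (see file header). [folklore] -/
theorem hex_newtonVertexCount_mul_le (p q : MvPolynomial (Fin 2) ℂ) (hp : p ≠ 0) (hq : q ≠ 0) :
    newtonVertexCount (p * q) ≤ 2 * (newtonVertexCount p + newtonVertexCount q) := by
  have h₁ := hex_ncard_chartTops_mul_le 1 (Or.inl rfl) p q hp hq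
  have h₂ := hex_ncard_chartTops_mul_le (-1) (Or.inr rfl) p q hp hq
  have h := stub_vertexCharts (p * q)
  omega

/-- A polynomial supported on the diagonal has at most `4` Newton vertices (in truth `2`). -/
theorem hex_newtonVertexCount_le_four_of_diag (D : MvPolynomial (Fin 2) ℂ) (hD : ∀ e ∈ D.support, e 0 = e 1) :
    newtonVertexCount D ≤ 4 := by
  by_cases hD0 : D = 0
  · rw [hD0, newtonVertexCount_zero]
    exact Nat.zero_le _
  have hne : D.support.Nonempty := by
    rw [Finset.nonempty_iff_ne_empty, Ne, support_eq_empty]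
    exact hD0
  obtain ⟨eMax, hMax, hMax'⟩ := Finset.exists_max_image D.support (fun e => e 0) hne
  obtain ⟨eMin, hMin, hMin'⟩ := Finset.exists_min_image D.support (fun e => e 0) hne
  have htwo : ∀ σ : ℝ,
      {e : Fin 2 →₀ ℕ | ∃ t : ℝ, IsGeneric ![σ, t] ∧ IsTop ![σ, t] D e}.ncard ≤ 2 := by
    intro σ
    calc {e : Fin 2 →₀ ℕ | ∃ t : ℝ, IsGeneric ![σ, t] ∧ IsTop ![σ, t] D e}.ncard
        ≤ ({eMax, eMin} : Set (Fin 2 →₀ ℕ)).ncard :=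
          Set.ncard_le_ncard
            (HexagonVertexToolsAux.chartTops_diag_subset σ D hD hMax hMax' hMin hMin')
            (Set.toFinite _)
      _ ≤ ({eMin} : Set (Fin 2 →₀ ℕ)).ncard + 1 := Set.ncard_insert_le _ _
      _ = 2 := by rw [Set.ncard_singleton]
  have h := stub_vertexCharts D
  have h₁ := htwo 1
  have h₂ := htwo (-1)
  omega

/-- (diagonal) × (separated of rank `R`) has at most `8 + 8R` Newton vertices. -/
theorem hex_vert_diag_mul_le {R : ℕ} (D m : MvPolynomial (Fin 2) ℂ) (hD : ∀ e ∈ D.support, e 0 = e 1)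
    (hm : ∃ P Q : Fin R → MvPolynomial (Fin 2) ℂ, (∀ r, ∀ e ∈ (P r).support, e 1 = 0) ∧
      (∀ r, ∀ e ∈ (Q r).support, e 0 = 0) ∧ m = ∑ r, P r * Q r) :
    vert (D * m) ≤ 8 + 8 * R := by
  obtain ⟨P, Q, hP, hQ, rfl⟩ := hm
  have hsep : vert (∑ r, P r * Q r) ≤ 4 * R := vert_sum_mul_le_of_separated R P Q hP hQ
  change newtonVertexCount (D * ∑ r, P r * Q r) ≤ 8 + 8 * R
  change newtonVertexCount (∑ r, P r * Q r) ≤ 4 * R at hsep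
  by_cases hD0 : D = 0
  · rw [hD0, zero_mul, newtonVertexCount_zero]
    exact Nat.zero_le _
  by_cases hm0 : ∑ r, P r * Q r = 0
  · rw [hm0, mul_zero, newtonVertexCount_zero]
    exact Nat.zero_le _
  have h1 := hex_newtonVertexCount_mul_le D _ hD0 hm0
  have h2 := hex_newtonVertexCount_le_four_of_diag D hD
  omega


end Summit.ValiantsHypothesis.ValiantsHypothesis.Theorems.NewtonUnitEquationsNewtonTauWeak

end
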